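import Literature.Algebra.Homology.LefschetzNumber
import Mathlib.LinearAlgebra.Matrix.Permutation
import HarnessLib

/-!
# The algebraic step of the Lefschetz fixed-point theorem: traces and Lefschetz numbers of maps moving every basis vector

Layer `Literature/Algebra/Homology` (pure linear algebra over Mathlib; proved theorems only, 0 definitions, 0 named facts, no instances,
no notation). Hatcher, *Algebraic Topology*, proof of Thm. 2C.3 (p. 180): for a simplicial map `g` with `g(σ) ∩ σ = ∅` for every simplex `σ`,
the matrix of `g♯` on the simplicial chains in the basis of simplices has zero diagonal, so `tr(g♯ : Cₙ → Cₙ) = 0` in every degree and, by the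
Hopf trace formula, `τ(g) = 0`; for a simplicial automorphism the same bookkeeping counts fixed simplices. With respect to a finite basis `b` of a
module `M` over a commutative ring and `f : M →ₗ M`:

* `trace_eq_sum_repr_apply_self` — `tr f = Σ_i [f(b i) : b i]` (the diagonal of Mathlib's `LinearMap.toMatrix`);
  **`trace_eq_zero_of_repr_apply_self_eq_zero`** — if no basis vector occurs in its own image, `tr f = 0`;
* `trace_eq_sum_fixedPoints_of_apply_basis` — if `f (b i) = ε i • b (σ i)` for a permutation `σ` and signs ∕ scalars `ε`, then
  `tr f = Σ_{σ i = i} ε i`; `trace_eq_ncard_fixedPoints_of_apply_basis` — `ε = 1`: `tr f = #Fix(σ)` (Mathlib's `Matrix.trace_permutation`, the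
  matrix of `f` being the transpose of `σ.permMatrix`);
* complex level, for an endomorphism `φ` of a homological complex of vector spaces with chosen finite bases `b i` of the terms, finitely many terms
  non-zero, row `LefschetzNumber`'s `Λ` and Hopf formula BY NAME: **`lefschetzNumber_eq_zero_of_forall_repr_apply_self_eq_zero`** (`Λ(φ) = 0` when
  no basis vector occurs in its own image in any degree), **`lefschetzNumber_eq_finsum_χ_smul_ncard_fixedPoints`** (`φ` permutes the bases:
  `Λ(φ) = Σᶠ χ(i) • #Fix(σ i)`, the Euler characteristic of the fixed sub-basis) and the signed form `lefschetzNumber_eq_finsum_χ_smul_sum_fixedPoints`.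

DEDUP: Mathlib has `Matrix.trace_permutation` (used) and no statement about linear maps or chain maps; the tree's `permMatrix` occurrences
(Birkhoff-polytope files, a private isotropy lemma) are unrelated. Library only (cell `pub-hodge-ring2`, count-neutral); proves nothing about any
crux, route or conjecture.

## References

* A. Hatcher, *Algebraic Topology* (2002), §2.C, proof of Thm. 2C.3 (p. 180). [HatcherAT2002]
* E. H. Spanier, *Algebraic Topology* (1981), Ch. 4 §7 (Lefschetz fixed-point theorem for simplicial maps). [Spanier1981]
* K. S. Brown, *Cohomology of Groups* (1982), IX §7 (Lefschetz numbers of automorphisms). [Brown1982]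
-/

open CategoryTheory CategoryTheory.Limits

universe v u w w'

namespace Literature.Algebra.Homology.LefschetzBasis

/-! ### One module with a finite basis -/

section Module

variable {K : Type u} [CommRing K] {M : Type v} [AddCommGroup M] [Module K M] {n : Type w} [Fintype n] [DecidableEq n]
  (b : Module.Basis n K M) (f : M →ₗ[K] M)

/-- `tr f = Σ_i [f(b i) : b i]`, the sum of the diagonal coefficients of `f` in the basis `b`. [cite: HatcherAT2002, §2.C (proof of 2C.3)] -/
theorem trace_eq_sum_repr_apply_self : LinearMap.trace K M f = ∑ i, b.repr (f (b i)) i := by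
  rw [LinearMap.trace_eq_matrix_trace K b f, Matrix.trace]
  exact Finset.sum_congr rfl fun i _ => LinearMap.toMatrix_apply b b f i i

/-- **If no basis vector occurs in its own image, the trace vanishes** ("`g(σ) ∩ σ = ∅` ⇒ `tr g♯ = 0`").
[cite: HatcherAT2002, §2.C (proof of 2C.3)] -/
theorem trace_eq_zero_of_repr_apply_self_eq_zero (h : ∀ i, b.repr (f (b i)) i = 0) : LinearMap.trace K M f = 0 := by
  rw [trace_eq_sum_repr_apply_self b f]
  exact Finset.sum_eq_zero fun i _ => h i

/-- **A map sending `b i` to `ε i • b (σ i)` has trace `Σ_{σ i = i} ε i`** (signed count of the fixed basis vectors).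
[cite: HatcherAT2002, §2.C (proof of 2C.3)] [cite: Brown1982, IX §7] -/
theorem trace_eq_sum_fixedPoints_of_apply_basis (σ : Equiv.Perm n) (ε : n → K) (h : ∀ i, f (b i) = ε i • b (σ i)) :
    LinearMap.trace K M f = ∑ i ∈ Finset.univ.filter (fun i => σ i = i), ε i := by
  rw [trace_eq_sum_repr_apply_self b f, Finset.sum_filter]
  refine Finset.sum_congr rfl fun i _ => ?_
  rw [h i, map_smul, b.repr_self, Finsupp.smul_apply, Finsupp.single_apply, smul_eq_mul, mul_ite, mul_one, mul_zero]

/-- **A map permuting the basis, `f (b i) = b (σ i)`, has trace the number of fixed points of `σ`** (the matrix of `f` is the transpose of the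
permutation matrix; Mathlib's `Matrix.trace_permutation`). [cite: HatcherAT2002, §2.C] [cite: Brown1982, IX §7] -/
theorem trace_eq_ncard_fixedPoints_of_apply_basis (σ : Equiv.Perm n) (h : ∀ i, f (b i) = b (σ i)) :
    LinearMap.trace K M f = (Function.fixedPoints σ).ncard := by
  have hM : LinearMap.toMatrix b b f = (σ.permMatrix K).transpose := Matrix.ext fun i j => by
    rw [LinearMap.toMatrix_apply, h j, b.repr_self, Finsupp.single_apply, Matrix.transpose_apply]
    change _ = σ.toPEquiv.toMatrix j i
    rw [PEquiv.toMatrix_apply, Equiv.toPEquiv_apply]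
    exact if_congr Option.mem_some_iff.symm rfl rfl
  rw [LinearMap.trace_eq_matrix_trace K b f, hM, Matrix.trace_transpose, Matrix.trace_permutation]

end Module

/-! ### Homological complexes with chosen bases: the Lefschetz number -/

section Complex

variable {K : Type u} [Field K] {ι : Type w} {c : ComplexShape ι} [c.EulerCharSigns] {C : HomologicalComplex (ModuleCat.{v} K) c}
  (φ : C ⟶ C) {n : ι → Type w'} [∀ i, Fintype (n i)] [∀ i, DecidableEq (n i)] (b : ∀ i, Module.Basis (n i) K (C.X i))
  (hC : (GradedObject.finrankSupport C.X).Finite)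

include b hC

/-- **`Λ(φ) = 0` when no basis vector occurs in its own image in any degree** — the algebraic step of the Lefschetz fixed-point theorem
(every `tr(φᵢ)` vanishes, then Hopf, row `LefschetzNumber`). [cite: HatcherAT2002, Thm. 2C.3 (proof)] [cite: Spanier1981, Ch. 4 §7] -/
theorem lefschetzNumber_eq_zero_of_forall_repr_apply_self_eq_zero (h : ∀ i (k : n i), (b i).repr ((φ.f i).hom (b i k)) k = 0) :
    Lefschetz.lefschetzNumber φ = 0 := by
  haveI : ∀ i, Module.Finite K (C.X i) := fun i => Module.Finite.of_basis (b i)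
  rw [Lefschetz.lefschetzNumber_eq_finsum_χ_smul_trace_f φ hC]
  exact finsum_eq_zero_of_forall_eq_zero fun i => by rw [trace_eq_zero_of_repr_apply_self_eq_zero (b i) _ (h i), smul_zero]

/-- **`Λ(φ) = Σᶠ χ(i) • Σ_{σᵢ k = k} εᵢ k`** for a chain map sending each basis vector `bᵢ k` to `εᵢ k • bᵢ (σᵢ k)` (signed count of the
fixed basis vectors, weighted by the Euler signs). [cite: HatcherAT2002, Thm. 2C.3 (proof)] [cite: Brown1982, IX §7] -/
theorem lefschetzNumber_eq_finsum_χ_smul_sum_fixedPoints (σ : ∀ i, Equiv.Perm (n i)) (ε : ∀ i, n i → K)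
    (h : ∀ i k, (φ.f i).hom (b i k) = ε i k • b i (σ i k)) :
    Lefschetz.lefschetzNumber φ = ∑ᶠ i, (c.χ i : ℤ) • ∑ k ∈ Finset.univ.filter (fun k => σ i k = k), ε i k := by
  haveI : ∀ i, Module.Finite K (C.X i) := fun i => Module.Finite.of_basis (b i)
  rw [Lefschetz.lefschetzNumber_eq_finsum_χ_smul_trace_f φ hC]
  exact finsum_congr fun i => by rw [trace_eq_sum_fixedPoints_of_apply_basis (b i) _ (σ i) (ε i) (h i)]

/-- **`Λ(φ) = Σᶠ χ(i) • #Fix(σᵢ)`** for a chain map permuting the chosen bases, `φᵢ(bᵢ k) = bᵢ(σᵢ k)`: the Lefschetz number is the Euler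
characteristic of the fixed sub-basis (e.g. of the fixed subcomplex of a simplicial automorphism). [cite: Brown1982, IX §7] [cite: HatcherAT2002, §2.C] -/
theorem lefschetzNumber_eq_finsum_χ_smul_ncard_fixedPoints (σ : ∀ i, Equiv.Perm (n i)) (h : ∀ i k, (φ.f i).hom (b i k) = b i (σ i k)) :
    Lefschetz.lefschetzNumber φ = ∑ᶠ i, (c.χ i : ℤ) • ((Function.fixedPoints (σ i)).ncard : K) := by
  haveI : ∀ i, Module.Finite K (C.X i) := fun i => Module.Finite.of_basis (b i)
  rw [Lefschetz.lefschetzNumber_eq_finsum_χ_smul_trace_f φ hC]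
  exact finsum_congr fun i => by rw [trace_eq_ncard_fixedPoints_of_apply_basis (b i) _ (σ i) (h i)]

end Complex

end Literature.Algebra.Homology.LefschetzBasis
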